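import Summits.QuantumFields.YangMills.Theorems.ColdStartUniversalityLatticeLangevinLiebRobinsonClustering
import Summits.QuantumFields.YangMills.Theorems.ColdStartUniversalityLatticeLangevinLiebRobinsonWordLightCone
import HarnessLib

/-!
# Route `ColdStartUniversality` (fixed-cut-off SZZ dynamics; LIEB–ROBINSON / LOCALITY package, file 17):
# ★★★ EXPONENTIAL DECAY OF WILSON-LOOP CORRELATIONS and SPACE-TIME CLUSTERING at `|β'| < 1/12`, every volume

Helper file (seat `ym-line-csu-p1`, g31; `--supports stmt-QuantumFields-24809`).  Corollaries of the clustering theorem of file 16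
(`wilson_covariance_abs_le_of_separated`, Lieb–Robinson light cone + volume-uniform `L²` gap) for the `SU(2)` Wilson measure `μ_(β')` on `(ℤ/L)³`:
* ★★★ `wilson_loop_covariance_abs_le` — for two loop words `w₁, w₂` whose links have base sites at cyclic sup-distance `≥ R+1`:
  `|⟨Re tr w₁·Re tr w₂⟩_(μ_β') − ⟨Re tr w₁⟩⟨Re tr w₂⟩| ≤ 32π²|w₁|²|w₂|²(1 + T_R)e^(−ρT_R)`, `T_R = (R+1) log 108/(λ+ρ)`, `ρ = 1 − 12|β'|`,
  `λ = (1300+4√2)|β'|` — decay `108^(−ρ(R+1)/(λ+ρ))`, constants blind to `L` and to the position of the loops (`word_linkLipschitz_profile`);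
* ★★★ `wilson_integral_mul_transition_sub_mean_le_of_separated` — SPACE-TIME clustering of the stationary SZZ process: for EVERY realising kernel
  family and EVERY lattice time `t`, `|∫ F·κ_t G dμ − μF·μG| ≤ (√Var F √Var G + 16 Σℓ^F Σℓ^G T_R) e^(−ρT_R)` for separated `C³` cylinder
  observables (before the crossover the light cone keeps `⟨F, κ_t G⟩` at the static value, which clusters; after it the gap has acted);
* ★★★ `wilson_cov_abs_le_of_separated`, `wilson_loop_cov_abs_le` — the same statements in Mathlib's vocabulary `cov[F, G; μ_(β')]`
  (`ProbabilityTheory.covariance_eq_sub`).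
THEOREMS ONLY, no definition, no sorry; [folklore] / [cite: ShenZhuZhu2022, Cor. 1.6 / Cor. 4.11 (shape)].  HONEST FRAMING: fixed cut-off, FIXED
strong-coupling window `|β'| < 1/12` (the route's `β'_K → ∞` leaves it); nothing `K`-uniform, nothing about the continuum limit;
`UniformColdStartMixing` (24809) is NOT restated; no crux, rung or summit statement is proved; the Yang–Mills mass gap is NOT proved.
-/

set_option autoImplicit false

noncomputable section

namespace Summit.QuantumFields.YangMills.Theorems.ColdStartUniversality.LiebRobinson

open MeasureTheory ProbabilityTheory Matrix Complex Finset Filter Set Metric intervalIntegral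
open scoped ComplexConjugate BigOperators Matrix NNReal ENNReal Topology
open Literature.Probability.Process Literature.MathematicalPhysics.QuantumFieldTheory
open Literature.MathematicalPhysics.QuantumFieldTheory.Balaban1983to89
open Literature.MathematicalPhysics.QuantumLattice (fundamentalRep fundamentalLatticeRep continuous_fundamentalRep fundamentalRep_apply)

variable {L : ℕ} [NeZero L]

/-! ## §1. Wilson loops: exponential decay of loop–loop correlations, uniformly in the volume -/

/-- ★★★ **EXPONENTIAL CLUSTERING OF WILSON LOOPS at `|β'| < 1/12`, every volume.**  For any two loop words `w₁, w₂` (lists of oriented links) on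
the torus `(ℤ/L)³` whose links have base sites at cyclic sup-distance `≥ R + 1` from each other:
`|⟨Re tr w₁ · Re tr w₂⟩_(μ_β') − ⟨Re tr w₁⟩⟨Re tr w₂⟩| ≤ 32π²·|w₁|²·|w₂|²·(1 + T_R)·e^(−ρ·T_R)`, `T_R = (R+1) log 108/(λ+ρ)`, `ρ = 1 − 12|β'|`,
`λ = (1300+4√2)|β'|` — the constants see neither `L` nor the position of the loops (`wilson_covariance_abs_le_of_separated'` with the word profiles
`2π|w|` on the links of `w`, `word_linkLipschitz_profile`).  Plaquette–plaquette: `|w| = 4`.  Fixed cut-off, strong coupling; the Yang–Mills mass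
gap is NOT proved. [folklore; cite: ShenZhuZhu2022, Cor. 1.6 (shape)] -/
theorem wilson_loop_covariance_abs_le (L : ℕ) [NeZero L] (β' : ℝ) (hβ : |β'| < 1 / 12) (l₁ l₂ : List (Edge 3 L × Bool)) (R : ℕ)
    (hsep : ∀ e' ∈ (l₁.map Prod.fst).toFinset, ∀ e ∈ (l₂.map Prod.fst).toFinset, R + 1 ≤ (Finset.univ.sup fun i : Fin 3 => ((e'.1 i - e.1 i).valMinAbs).natAbs)) :
    let coords : GaugeConfig 3 L (Matrix.specialUnitaryGroup (Fin 2) ℂ) → (Edge 3 L × Fin 2 × Fin 2 × Bool → ℝ) :=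
      fun V q => (fun z : ℂ => if q.2.2.2 then z.im else z.re)
        ((fundamentalRep (Fin 2) (V q.1) : Matrix (Fin 2) (Fin 2) ℂ) q.2.1 q.2.2.1)
    |(∫ x, (fun y : (Edge 3 L × Fin 2 × Fin 2 × Bool → ℝ) => ((l₁.map (fun a : Edge 3 L × Bool => if a.2 then ((fun (ee : Edge 3 L) => Matrix.of fun (i j : Fin 2) => ((y (ee, i, j, false) : ℝ) : ℂ) + ((y (ee, i, j, true) : ℝ) : ℂ) * Complex.I) a.1)ᴴ else (fun (ee : Edge 3 L) => Matrix.of fun (i j : Fin 2) => ((y (ee, i, j, false) : ℝ) : ℂ) + ((y (ee, i, j, true) : ℝ) : ℂ) * Complex.I) a.1)).prod).trace.re) (coords x) * (fun y : (Edge 3 L × Fin 2 × Fin 2 × Bool → ℝ) => ((l₂.map (fun a : Edge 3 L × Bool => if a.2 then ((fun (ee : Edge 3 L) => Matrix.of fun (i j : Fin 2) => ((y (ee, i, j, false) : ℝ) : ℂ) + ((y (ee, i, j, true) : ℝ) : ℂ) * Complex.I) a.1)ᴴ else (fun (ee : Edge 3 L) => Matrix.of fun (i j : Fin 2) => ((y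 (ee, i, j, false) : ℝ) : ℂ) + ((y (ee, i, j, true) : ℝ) : ℂ) * Complex.I) a.1)).prod).trace.re) (coords x) ∂(wilsonMeasure (d := 3) (L := L) (fundamentalRep (Fin 2)) β')) -
        (∫ x, (fun y : (Edge 3 L × Fin 2 × Fin 2 × Bool → ℝ) => ((l₁.map (fun a : Edge 3 L × Bool => if a.2 then ((fun (ee : Edge 3 L) => Matrix.of fun (i j : Fin 2) => ((y (ee, i, j, false) : ℝ) : ℂ) + ((y (ee, i, j, true) : ℝ) : ℂ) * Complex.I) a.1)ᴴ else (fun (ee : Edge 3 L) => Matrix.of fun (i j : Fin 2) => ((y (ee, i, j, false) : ℝ) : ℂ) + ((y (ee, i, j, true) : ℝ) : ℂ) * Complex.I) a.1)).prod).trace.re) (coords x) ∂(wilsonMeasure (d := 3) (L := L) (fundamentalRep (Fin 2)) β')) * (∫ x, (fun y : (Edge 3 L × Fin 2 × Fin 2 × Bool → ℝ) => ((l₂.map (fun a : Edge 3 L × Bool => if a.2 then ((fun (ee : Edge 3 L) => Matrix.of fun (i j : Fin 2) => ((y (ee, i, j, false) : ℝ) : ℂ) + ((y (ee, i, j, true)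 : ℝ) : ℂ) * Complex.I) a.1)ᴴ else (fun (ee : Edge 3 L) => Matrix.of fun (i j : Fin 2) => ((y (ee, i, j, false) : ℝ) : ℂ) + ((y (ee, i, j, true) : ℝ) : ℂ) * Complex.I) a.1)).prod).trace.re) (coords x) ∂(wilsonMeasure (d := 3) (L := L) (fundamentalRep (Fin 2)) β'))| ≤
      32 * Real.pi ^ 2 * (l₁.length : ℝ) ^ 2 * (l₂.length : ℝ) ^ 2 * (1 + (((R : ℝ) + 1) * Real.log 108 / ((1300 + 4 * Real.sqrt 2) * |β'| + (1 - 12 * |β'|)))) * Real.exp (-((1 - 12 * |β'|) * (((R : ℝ) + 1) * Real.log 108 / ((1300 + 4 * Real.sqrt 2) * |β'| + (1 - 12 * |β'|))))) := by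
  intro coords
  classical
  set ℓF : Edge 3 L → ℝ := fun e => if e ∈ (l₁.map Prod.fst).toFinset then 2 * Real.pi * (l₁.length : ℝ) else 0 with hℓF
  set ℓG : Edge 3 L → ℝ := fun e => if e ∈ (l₂.map Prod.fst).toFinset then 2 * Real.pi * (l₂.length : ℝ) else 0 with hℓG
  have hℓF0 : ∀ e, 0 ≤ ℓF e := fun e => by
    simp only [hℓF]; split_ifs
    · positivity
    · exact le_rfl
  have hℓG0 : ∀ e, 0 ≤ ℓG e := fun e => by
    simp only [hℓG]; split_ifs
    · positivity
    · exact le_rfl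
  have hΛF : ∀ e, e ∉ (l₁.map Prod.fst).toFinset → ℓF e = 0 := fun e he => by simp only [hℓF, he, if_false]
  have hΛG : ∀ e, e ∉ (l₂.map Prod.fst).toFinset → ℓG e = 0 := fun e he => by simp only [hℓG, he, if_false]
  have hLf := word_linkLipschitz_profile L β' l₁
  have hLg := word_linkLipschitz_profile L β' l₂
  have key := wilson_covariance_abs_le_of_separated' L β' hβ (contDiff_word (L := L) l₁ (m := 3)) hℓF0 (contDiff_word (L := L) l₂ (m := 3)) hℓG0
    (l₁.map Prod.fst).toFinset (l₂.map Prod.fst).toFinset hΛF hΛG R hsep (fun e y y' h => hLf e y y' h) (fun e y y' h => hLg e y y' h)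
  refine key.trans ?_
  have hsum : ∀ (l : List (Edge 3 L × Bool)),
      (∑ e : Edge 3 L, (if e ∈ (l.map Prod.fst).toFinset then 2 * Real.pi * (l.length : ℝ) else 0)) ≤ 2 * Real.pi * (l.length : ℝ) ^ 2 := by
    intro l
    have hcard : (((l.map Prod.fst).toFinset.card : ℕ) : ℝ) ≤ l.length := by
      have h1 := List.toFinset_card_le (l.map Prod.fst)
      rw [List.length_map] at h1
      exact_mod_cast h1
    rw [Finset.sum_ite_mem, Finset.univ_inter, Finset.sum_const, nsmul_eq_mul]
    calc ((l.map Prod.fst).toFinset.card : ℝ) * (2 * Real.pi * (l.length : ℝ)) ≤ (l.length : ℝ) * (2 * Real.pi * (l.length : ℝ)) :=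
        mul_le_mul_of_nonneg_right hcard (by positivity)
      _ = 2 * Real.pi * (l.length : ℝ) ^ 2 := by ring
  have hF := hsum l₁
  have hG := hsum l₂
  have hlam0 : 0 ≤ (1300 + 4 * Real.sqrt 2) * |β'| := by positivity
  have hrho : 0 < (1 - 12 * |β'|) := by linarith
  have hden : 0 < (1300 + 4 * Real.sqrt 2) * |β'| + (1 - 12 * |β'|) := by linarith
  have hlog : 0 < Real.log 108 := Real.log_pos (by norm_num)
  have hT : 0 ≤ (((R : ℝ) + 1) * Real.log 108 / ((1300 + 4 * Real.sqrt 2) * |β'| + (1 - 12 * |β'|))) := by positivity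
  have hrest : 0 ≤ (1 + (((R : ℝ) + 1) * Real.log 108 / ((1300 + 4 * Real.sqrt 2) * |β'| + (1 - 12 * |β'|)))) * Real.exp (-((1 - 12 * |β'|) * (((R : ℝ) + 1) * Real.log 108 / ((1300 + 4 * Real.sqrt 2) * |β'| + (1 - 12 * |β'|))))) := by positivity
  have hSF : 0 ≤ ∑ e : Edge 3 L, ℓF e := Finset.sum_nonneg fun e _ => hℓF0 e
  calc 8 * (∑ e : Edge 3 L, ℓF e) * (∑ e : Edge 3 L, ℓG e) * (1 + (((R : ℝ) + 1) * Real.log 108 / ((1300 + 4 * Real.sqrt 2) * |β'| + (1 - 12 * |β'|)))) * Real.exp (-((1 - 12 * |β'|) * (((R : ℝ) + 1) * Real.log 108 / ((1300 + 4 * Real.sqrt 2) * |β'| + (1 - 12 * |β'|)))))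
      = 8 * ((∑ e : Edge 3 L, ℓF e) * (∑ e : Edge 3 L, ℓG e)) * ((1 + (((R : ℝ) + 1) * Real.log 108 / ((1300 + 4 * Real.sqrt 2) * |β'| + (1 - 12 * |β'|)))) * Real.exp (-((1 - 12 * |β'|) * (((R : ℝ) + 1) * Real.log 108 / ((1300 + 4 * Real.sqrt 2) * |β'| + (1 - 12 * |β'|)))))) := by ring
    _ ≤ 8 * ((2 * Real.pi * (l₁.length : ℝ) ^ 2) * (2 * Real.pi * (l₂.length : ℝ) ^ 2)) * ((1 + (((R : ℝ) + 1) * Real.log 108 / ((1300 + 4 * Real.sqrt 2) * |β'| + (1 - 12 * |β'|)))) * Real.exp (-((1 - 12 * |β'|) * (((R : ℝ) + 1) * Real.log 108 / ((1300 + 4 * Real.sqrt 2) * |β'| + (1 - 12 * |β'|)))))) := by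
        refine mul_le_mul_of_nonneg_right (mul_le_mul_of_nonneg_left ?_ (by norm_num)) hrest
        exact mul_le_mul hF hG (Finset.sum_nonneg fun e _ => hℓG0 e) (by positivity)
    _ = _ := by ring


/-! ## §2. Space-time clustering: the stationary time-correlations, uniformly in time -/

/-- ★★★ **Space-time clustering of the stationary SZZ process** (`|β'| < 1/12`, every volume).  For `C³` cylinder observables `F, G` with
link-Lipschitz profiles supported on link sets at cyclic sup-distance `≥ R+1`, EVERY realising kernel family `κ` and EVERY lattice time `t`:
`|∫ F·κ_t G dμ_(β') − μF·μG| ≤ (√Var F √Var G + 16 Σℓ^F Σℓ^G·T_R)·e^(−ρT_R)` (and, from `wilson_integral_mul_transition_sub_mean_le`, also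
`≤ e^(−ρt)√Var F √Var G`): the equilibrium correlation of `F(U_0)` and `G(U_t)` is small as soon as EITHER the supports are far apart OR `t` is
large — before the crossover time the light cone keeps `⟨F, κ_t G⟩` near `⟨F G⟩`, which clusters; after it the gap has acted. [folklore] -/
theorem wilson_integral_mul_transition_sub_mean_le_of_separated (L : ℕ) [NeZero L] (β' : ℝ) (hβ : |β'| < 1 / 12)
    (κ : ℝ≥0 → Kernel (GaugeConfig 3 L (Matrix.specialUnitaryGroup (Fin 2) ℂ))
      (GaugeConfig 3 L (Matrix.specialUnitaryGroup (Fin 2) ℂ))) [∀ t, IsMarkovKernel (κ t)]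
    (hreal : ∀ (t : ℝ≥0) (x : GaugeConfig 3 L (Matrix.specialUnitaryGroup (Fin 2) ℂ))
        (Ω : Type) [MeasurableSpace Ω] (P : Measure Ω) [IsProbabilityMeasure P]
        (W : ℝ≥0 → Ω → (Edge 3 L × NoiseIdx 2 → ℝ)) (hW : IsFlatBrownian W P)
        (U : ℝ≥0 → Ω → GaugeConfig 3 L (Matrix.specialUnitaryGroup (Fin 2) ℂ)),
        (∀ ω, U 0 ω = x) →
        (latticeLangevinDynamics (fundamentalLatticeRep 2) β').IsSolution (fundamentalRep (Fin 2))
          hW.natFiltration P W U →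
        κ t x = P.map (U t))
    {f : (Edge 3 L × Fin 2 × Fin 2 × Bool → ℝ) → ℝ} (hf : ContDiff ℝ 3 f) {ℓF : Edge 3 L → ℝ} (hℓF : ∀ e, 0 ≤ ℓF e)
    {g : (Edge 3 L × Fin 2 × Fin 2 × Bool → ℝ) → ℝ} (hg : ContDiff ℝ 3 g) {ℓG : Edge 3 L → ℝ} (hℓG : ∀ e, 0 ≤ ℓG e)
    (Λf Λg : Finset (Edge 3 L)) (hΛf : ∀ e, e ∉ Λf → ℓF e = 0) (hΛg : ∀ e, e ∉ Λg → ℓG e = 0) (R : ℕ)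
    (hsep : ∀ e' ∈ Λf, ∀ e ∈ Λg, R + 1 ≤ (Finset.univ.sup fun i : Fin 3 => ((e'.1 i - e.1 i).valMinAbs).natAbs)) (t : ℝ≥0) :
    let coords : GaugeConfig 3 L (Matrix.specialUnitaryGroup (Fin 2) ℂ) → (Edge 3 L × Fin 2 × Fin 2 × Bool → ℝ) :=
      fun V q => (fun z : ℂ => if q.2.2.2 then z.im else z.re)
        ((fundamentalRep (Fin 2) (V q.1) : Matrix (Fin 2) (Fin 2) ℂ) q.2.1 q.2.2.1)
    (∀ (e : Edge 3 L) (y y' : (GaugeConfig 3 L (Matrix.specialUnitaryGroup (Fin 2) ℂ))), (∀ f', f' ≠ e → y f' = y' f') →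
      |f (coords y) - f (coords y')| ≤ ℓF e * frobNorm ((y e : Matrix (Fin 2) (Fin 2) ℂ) - (y' e : Matrix (Fin 2) (Fin 2) ℂ))) →
    (∀ (e : Edge 3 L) (y y' : (GaugeConfig 3 L (Matrix.specialUnitaryGroup (Fin 2) ℂ))), (∀ f', f' ≠ e → y f' = y' f') →
      |g (coords y) - g (coords y')| ≤ ℓG e * frobNorm ((y e : Matrix (Fin 2) (Fin 2) ℂ) - (y' e : Matrix (Fin 2) (Fin 2) ℂ))) →
    |(∫ x, f (coords x) * (∫ y, g (coords y) ∂(κ t x)) ∂(wilsonMeasure (d := 3) (L := L) (fundamentalRep (Fin 2)) β')) - (∫ x, f (coords x) ∂(wilsonMeasure (d := 3) (L := L) (fundamentalRep (Fin 2)) β')) * (∫ x, g (coords x) ∂(wilsonMeasure (d := 3) (L := L) (fundamentalRep (Fin 2)) β'))| ≤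
      (Real.sqrt (∫ x, (f (coords x) - ∫ z, f (coords z) ∂(wilsonMeasure (d := 3) (L := L) (fundamentalRep (Fin 2)) β')) ^ 2 ∂(wilsonMeasure (d := 3) (L := L) (fundamentalRep (Fin 2)) β')) * Real.sqrt (∫ x, (g (coords x) - ∫ z, g (coords z) ∂(wilsonMeasure (d := 3) (L := L) (fundamentalRep (Fin 2)) β')) ^ 2 ∂(wilsonMeasure (d := 3) (L := L) (fundamentalRep (Fin 2)) β')) + 16 * (∑ e : Edge 3 L, ℓF e) * (∑ e : Edge 3 L, ℓG e) * (((R : ℝ) + 1) * Real.log 108 / ((1300 + 4 * Real.sqrt 2) * |β'| + (1 - 12 * |β'|)))) *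
        Real.exp (-((1 - 12 * |β'|) * (((R : ℝ) + 1) * Real.log 108 / ((1300 + 4 * Real.sqrt 2) * |β'| + (1 - 12 * |β'|))))) := by
  intro coords hLf hLg
  classical
  haveI := secondCountableTopology_su2
  haveI := borelSpace_config L
  set μ : Measure (GaugeConfig 3 L (Matrix.specialUnitaryGroup (Fin 2) ℂ)) := (wilsonMeasure (d := 3) (L := L) (fundamentalRep (Fin 2)) β') with hμ
  haveI : IsProbabilityMeasure μ :=
    isProbabilityMeasure_wilsonMeasure (d := 3) (L := L) (fundamentalRep (Fin 2)) (continuous_fundamentalRep (Fin 2)) β'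
  have hlam0 : 0 ≤ (1300 + 4 * Real.sqrt 2) * |β'| := by positivity
  have hrho : 0 < (1 - 12 * |β'|) := by linarith
  have hden : 0 < (1300 + 4 * Real.sqrt 2) * |β'| + (1 - 12 * |β'|) := by linarith
  have hlog : 0 < Real.log 108 := Real.log_pos (by norm_num)
  set T : ℝ := (((R : ℝ) + 1) * Real.log 108 / ((1300 + 4 * Real.sqrt 2) * |β'| + (1 - 12 * |β'|))) with hTdef
  have hT : 0 ≤ T := by rw [hTdef]; positivity
  have hco : Continuous coords := continuous_coords (L := L)
  have hFc : Continuous fun V => f (coords V) := hf.continuous.comp hco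
  have hGc : Continuous fun V => g (coords V) := hg.continuous.comp hco
  set VF : ℝ := Real.sqrt (∫ x, (f (coords x) - ∫ z, f (coords z) ∂(wilsonMeasure (d := 3) (L := L) (fundamentalRep (Fin 2)) β')) ^ 2 ∂(wilsonMeasure (d := 3) (L := L) (fundamentalRep (Fin 2)) β')) with hVFdef
  set VG : ℝ := Real.sqrt (∫ x, (g (coords x) - ∫ z, g (coords z) ∂(wilsonMeasure (d := 3) (L := L) (fundamentalRep (Fin 2)) β')) ^ 2 ∂(wilsonMeasure (d := 3) (L := L) (fundamentalRep (Fin 2)) β')) with hVGdef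
  have hVF : 0 ≤ VF := Real.sqrt_nonneg _
  have hVG : 0 ≤ VG := Real.sqrt_nonneg _
  have hSF : 0 ≤ ∑ e : Edge 3 L, ℓF e := Finset.sum_nonneg fun e _ => hℓF e
  have hSG : 0 ≤ ∑ e : Edge 3 L, ℓG e := Finset.sum_nonneg fun e _ => hℓG e
  have hE : 0 ≤ Real.exp (-((1 - 12 * |β'|) * T)) := (Real.exp_pos _).le
  -- static clustering
  have hcl : |(∫ x, f (coords x) * g (coords x) ∂μ) - (∫ x, f (coords x) ∂μ) * (∫ x, g (coords x) ∂μ)| ≤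
      (VF * VG + 8 * (∑ e : Edge 3 L, ℓF e) * (∑ e : Edge 3 L, ℓG e) * T) * Real.exp (-((1 - 12 * |β'|) * T)) :=
    wilson_covariance_abs_le_of_separated L β' hβ hf hℓF hg hℓG Λf Λg hΛf hΛg R hsep hLf hLg
  -- relaxation at time `t`
  have hrel : |(∫ x, f (coords x) * (∫ y, g (coords y) ∂(κ t x)) ∂(wilsonMeasure (d := 3) (L := L) (fundamentalRep (Fin 2)) β')) - (∫ x, f (coords x) ∂(wilsonMeasure (d := 3) (L := L) (fundamentalRep (Fin 2)) β')) * (∫ x, g (coords x) ∂(wilsonMeasure (d := 3) (L := L) (fundamentalRep (Fin 2)) β'))| ≤ Real.exp (-((1 - 12 * |β'|) * (t : ℝ))) * VF * VG :=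
    wilson_integral_mul_transition_sub_mean_le L β' hβ κ hreal hFc hGc t
  by_cases ht : T ≤ (t : ℝ)
  · -- after the crossover: the gap alone suffices
    have hexp : Real.exp (-((1 - 12 * |β'|) * (t : ℝ))) ≤ Real.exp (-((1 - 12 * |β'|) * T)) :=
      Real.exp_le_exp.2 (by nlinarith)
    calc |(∫ x, f (coords x) * (∫ y, g (coords y) ∂(κ t x)) ∂(wilsonMeasure (d := 3) (L := L) (fundamentalRep (Fin 2)) β')) - (∫ x, f (coords x) ∂(wilsonMeasure (d := 3) (L := L) (fundamentalRep (Fin 2)) β')) * (∫ x, g (coords x) ∂(wilsonMeasure (d := 3) (L := L) (fundamentalRep (Fin 2)) β'))| ≤ Real.exp (-((1 - 12 * |β'|) * (t : ℝ))) * VF * VG := hrel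
      _ ≤ Real.exp (-((1 - 12 * |β'|) * T)) * VF * VG := by
          have := mul_le_mul_of_nonneg_right (mul_le_mul_of_nonneg_right hexp hVF) hVG; exact this
      _ ≤ (VF * VG + 16 * (∑ e : Edge 3 L, ℓF e) * (∑ e : Edge 3 L, ℓG e) * T) * Real.exp (-((1 - 12 * |β'|) * T)) := by
          have h0 : 0 ≤ 16 * (∑ e : Edge 3 L, ℓF e) * (∑ e : Edge 3 L, ℓG e) * T := by positivity
          nlinarith
  · -- before the crossover: light cone + static clustering
    push Not at ht
    obtain ⟨g', hg', hg'c, hg'eq⟩ := exists_compactSupport_eqOn_unitBall (L := L) hg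
    have hgg : ∀ V : (GaugeConfig 3 L (Matrix.specialUnitaryGroup (Fin 2) ℂ)), g' (coords V) = g (coords V) :=
      fun V => hg'eq _ (norm_flatCoords_le_one (L := L) V)
    have hLg' : (∀ (e : Edge 3 L) (y y' : (GaugeConfig 3 L (Matrix.specialUnitaryGroup (Fin 2) ℂ))), (∀ f', f' ≠ e → y f' = y' f') →
      |g' (coords y) - g' (coords y')| ≤ ℓG e * frobNorm ((y e : Matrix (Fin 2) (Fin 2) ℂ) - (y' e : Matrix (Fin 2) (Fin 2) ℂ))) := by
      intro e y y' h; rw [hgg, hgg]; exact hLg e y y' h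
    have h1 : |(∫ x, f (coords x) * (∫ y, g' (coords y) ∂(κ (t : ℝ).toNNReal x)) ∂μ) - ∫ x, f (coords x) * g' (coords x) ∂μ| ≤
        8 * (t : ℝ) * Real.exp ((1300 + 4 * Real.sqrt 2) * |β'| * (t : ℝ)) * ∑ e : Edge 3 L, ∑ e' : Edge 3 L, ℓG e * ℓF e' * ((108 : ℝ)⁻¹) ^ (Finset.univ.sup fun i : Fin 3 => ((e'.1 i - e.1 i).valMinAbs).natAbs) :=
      wilson_integral_mul_transition_sub_le L β' κ hreal hf hℓF hg' hg'c hℓG t.2 hLf hLg'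
    rw [Real.toNNReal_coe] at h1
    simp only [hgg] at h1
    have hS := doubleSum_profile_le_of_separated hℓF hℓG Λf Λg hΛf hΛg R hsep
    have hcross : Real.exp ((1300 + 4 * Real.sqrt 2) * |β'| * T) * ((108 : ℝ)⁻¹) ^ (R + 1) = Real.exp (-((1 - 12 * |β'|) * T)) := by
      rw [hTdef]; exact exp_mul_crossover_mul_pow_eq β' R hden
    have hS0 : 0 ≤ ∑ e : Edge 3 L, ∑ e' : Edge 3 L, ℓG e * ℓF e' * ((108 : ℝ)⁻¹) ^ (Finset.univ.sup fun i : Fin 3 => ((e'.1 i - e.1 i).valMinAbs).natAbs) := Finset.sum_nonneg fun e _ => Finset.sum_nonneg fun e' _ =>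
      mul_nonneg (mul_nonneg (hℓG e) (hℓF e')) (by positivity)
    have hlc : 8 * (t : ℝ) * Real.exp ((1300 + 4 * Real.sqrt 2) * |β'| * (t : ℝ)) * ∑ e : Edge 3 L, ∑ e' : Edge 3 L, ℓG e * ℓF e' * ((108 : ℝ)⁻¹) ^ (Finset.univ.sup fun i : Fin 3 => ((e'.1 i - e.1 i).valMinAbs).natAbs) ≤
        8 * T * ((∑ e : Edge 3 L, ℓF e) * ∑ e : Edge 3 L, ℓG e) * Real.exp (-((1 - 12 * |β'|) * T)) := by
      have hexp : Real.exp ((1300 + 4 * Real.sqrt 2) * |β'| * (t : ℝ)) ≤ Real.exp ((1300 + 4 * Real.sqrt 2) * |β'| * T) := Real.exp_le_exp.2 (by nlinarith)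
      calc 8 * (t : ℝ) * Real.exp ((1300 + 4 * Real.sqrt 2) * |β'| * (t : ℝ)) * ∑ e : Edge 3 L, ∑ e' : Edge 3 L, ℓG e * ℓF e' * ((108 : ℝ)⁻¹) ^ (Finset.univ.sup fun i : Fin 3 => ((e'.1 i - e.1 i).valMinAbs).natAbs)
          ≤ 8 * T * Real.exp ((1300 + 4 * Real.sqrt 2) * |β'| * T) * (((108 : ℝ)⁻¹) ^ (R + 1) * ((∑ e : Edge 3 L, ℓF e) * ∑ e : Edge 3 L, ℓG e)) := by
            refine mul_le_mul (mul_le_mul (mul_le_mul_of_nonneg_left ht.le (by norm_num)) hexp (Real.exp_pos _).le (by positivity)) hS hS0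
              (by positivity)
        _ = 8 * T * ((∑ e : Edge 3 L, ℓF e) * ∑ e : Edge 3 L, ℓG e) * (Real.exp ((1300 + 4 * Real.sqrt 2) * |β'| * T) * ((108 : ℝ)⁻¹) ^ (R + 1)) := by ring
        _ = _ := by rw [hcross]
    calc |(∫ x, f (coords x) * (∫ y, g (coords y) ∂(κ t x)) ∂(wilsonMeasure (d := 3) (L := L) (fundamentalRep (Fin 2)) β')) - (∫ x, f (coords x) ∂(wilsonMeasure (d := 3) (L := L) (fundamentalRep (Fin 2)) β')) * (∫ x, g (coords x) ∂(wilsonMeasure (d := 3) (L := L) (fundamentalRep (Fin 2)) β'))|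
        = |((∫ x, f (coords x) * (∫ y, g (coords y) ∂(κ t x)) ∂μ) - ∫ x, f (coords x) * g (coords x) ∂μ) +
            ((∫ x, f (coords x) * g (coords x) ∂μ) - (∫ x, f (coords x) ∂μ) * (∫ x, g (coords x) ∂μ))| := by congr 1; ring
      _ ≤ |(∫ x, f (coords x) * (∫ y, g (coords y) ∂(κ t x)) ∂μ) - ∫ x, f (coords x) * g (coords x) ∂μ| +
            |(∫ x, f (coords x) * g (coords x) ∂μ) - (∫ x, f (coords x) ∂μ) * (∫ x, g (coords x) ∂μ)| := abs_add_le _ _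
      _ ≤ 8 * T * ((∑ e : Edge 3 L, ℓF e) * ∑ e : Edge 3 L, ℓG e) * Real.exp (-((1 - 12 * |β'|) * T)) +
            (VF * VG + 8 * (∑ e : Edge 3 L, ℓF e) * (∑ e : Edge 3 L, ℓG e) * T) * Real.exp (-((1 - 12 * |β'|) * T)) :=
          add_le_add (h1.trans hlc) hcl
      _ = _ := by ring


/-! ## §3. The same in Mathlib's covariance vocabulary `cov[·, ·; μ_(β')]` -/

/-- ★★★ **Exponential clustering, `cov` form** (`|β'| < 1/12`, every `L`): for `C³` cylinder observables with link-Lipschitz profiles supported on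
link sets at cyclic sup-distance `≥ R+1`, `|cov[F, G; μ_(β')]| ≤ 8·Σℓ^F·Σℓ^G·(1 + T_R)·e^(−ρT_R)`, `T_R = (R+1) log 108/(λ+ρ)`
(`wilson_covariance_abs_le_of_separated'` + `ProbabilityTheory.covariance_eq_sub`). [folklore; cite: ShenZhuZhu2022, Cor. 4.11 (shape)] -/
theorem wilson_cov_abs_le_of_separated (L : ℕ) [NeZero L] (β' : ℝ) (hβ : |β'| < 1 / 12)
    {f : (Edge 3 L × Fin 2 × Fin 2 × Bool → ℝ) → ℝ} (hf : ContDiff ℝ 3 f) {ℓF : Edge 3 L → ℝ} (hℓF : ∀ e, 0 ≤ ℓF e)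
    {g : (Edge 3 L × Fin 2 × Fin 2 × Bool → ℝ) → ℝ} (hg : ContDiff ℝ 3 g) {ℓG : Edge 3 L → ℝ} (hℓG : ∀ e, 0 ≤ ℓG e)
    (Λf Λg : Finset (Edge 3 L)) (hΛf : ∀ e, e ∉ Λf → ℓF e = 0) (hΛg : ∀ e, e ∉ Λg → ℓG e = 0) (R : ℕ)
    (hsep : ∀ e' ∈ Λf, ∀ e ∈ Λg, R + 1 ≤ (Finset.univ.sup fun i : Fin 3 => ((e'.1 i - e.1 i).valMinAbs).natAbs)) :
    let coords : GaugeConfig 3 L (Matrix.specialUnitaryGroup (Fin 2) ℂ) → (Edge 3 L × Fin 2 × Fin 2 × Bool → ℝ) :=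
      fun V q => (fun z : ℂ => if q.2.2.2 then z.im else z.re)
        ((fundamentalRep (Fin 2) (V q.1) : Matrix (Fin 2) (Fin 2) ℂ) q.2.1 q.2.2.1)
    (∀ (e : Edge 3 L) (y y' : (GaugeConfig 3 L (Matrix.specialUnitaryGroup (Fin 2) ℂ))), (∀ f', f' ≠ e → y f' = y' f') →
      |f (coords y) - f (coords y')| ≤ ℓF e * frobNorm ((y e : Matrix (Fin 2) (Fin 2) ℂ) - (y' e : Matrix (Fin 2) (Fin 2) ℂ))) →
    (∀ (e : Edge 3 L) (y y' : (GaugeConfig 3 L (Matrix.specialUnitaryGroup (Fin 2) ℂ))), (∀ f', f' ≠ e → y f' = y' f') →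
      |g (coords y) - g (coords y')| ≤ ℓG e * frobNorm ((y e : Matrix (Fin 2) (Fin 2) ℂ) - (y' e : Matrix (Fin 2) (Fin 2) ℂ))) →
    |cov[fun x => f (coords x), fun x => g (coords x); (wilsonMeasure (d := 3) (L := L) (fundamentalRep (Fin 2)) β')]| ≤
      8 * (∑ e : Edge 3 L, ℓF e) * (∑ e : Edge 3 L, ℓG e) * (1 + (((R : ℝ) + 1) * Real.log 108 / ((1300 + 4 * Real.sqrt 2) * |β'| + (1 - 12 * |β'|)))) * Real.exp (-((1 - 12 * |β'|) * (((R : ℝ) + 1) * Real.log 108 / ((1300 + 4 * Real.sqrt 2) * |β'| + (1 - 12 * |β'|))))) := by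
  intro coords hLf hLg
  classical
  haveI := secondCountableTopology_su2
  haveI := borelSpace_config L
  haveI : IsProbabilityMeasure (wilsonMeasure (d := 3) (L := L) (fundamentalRep (Fin 2)) β') :=
    isProbabilityMeasure_wilsonMeasure (d := 3) (L := L) (fundamentalRep (Fin 2)) (continuous_fundamentalRep (Fin 2)) β'
  have hco : Continuous coords := continuous_coords (L := L)
  have hFc : Continuous fun V => f (coords V) := hf.continuous.comp hco
  have hGc : Continuous fun V => g (coords V) := hg.continuous.comp hco
  obtain ⟨MF, -, hMF⟩ := exists_abs_le_of_continuous hFc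
  obtain ⟨MG, -, hMG⟩ := exists_abs_le_of_continuous hGc
  have hX : MemLp (fun V => f (coords V)) 2 (wilsonMeasure (d := 3) (L := L) (fundamentalRep (Fin 2)) β') :=
    MemLp.of_bound hFc.aestronglyMeasurable MF (ae_of_all _ fun x => by rw [Real.norm_eq_abs]; exact hMF x)
  have hY : MemLp (fun V => g (coords V)) 2 (wilsonMeasure (d := 3) (L := L) (fundamentalRep (Fin 2)) β') :=
    MemLp.of_bound hGc.aestronglyMeasurable MG (ae_of_all _ fun x => by rw [Real.norm_eq_abs]; exact hMG x)
  rw [ProbabilityTheory.covariance_eq_sub hX hY]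
  exact wilson_covariance_abs_le_of_separated' L β' hβ hf hℓF hg hℓG Λf Λg hΛf hΛg R hsep hLf hLg

/-- ★★★ **Exponential decay of Wilson-loop covariances, `cov` form** (`|β'| < 1/12`, every `L`):
`|cov[Re tr w₁, Re tr w₂; μ_(β')]| ≤ 32π²|w₁|²|w₂|²(1 + T_R)e^(−ρT_R)` for loop words at cyclic sup-distance `≥ R+1`. [folklore; cite: ShenZhuZhu2022, Cor. 1.6 (shape)] -/
theorem wilson_loop_cov_abs_le (L : ℕ) [NeZero L] (β' : ℝ) (hβ : |β'| < 1 / 12) (l₁ l₂ : List (Edge 3 L × Bool)) (R : ℕ)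
    (hsep : ∀ e' ∈ (l₁.map Prod.fst).toFinset, ∀ e ∈ (l₂.map Prod.fst).toFinset, R + 1 ≤ (Finset.univ.sup fun i : Fin 3 => ((e'.1 i - e.1 i).valMinAbs).natAbs)) :
    let coords : GaugeConfig 3 L (Matrix.specialUnitaryGroup (Fin 2) ℂ) → (Edge 3 L × Fin 2 × Fin 2 × Bool → ℝ) :=
      fun V q => (fun z : ℂ => if q.2.2.2 then z.im else z.re)
        ((fundamentalRep (Fin 2) (V q.1) : Matrix (Fin 2) (Fin 2) ℂ) q.2.1 q.2.2.1)
    |cov[fun x => (fun y : (Edge 3 L × Fin 2 × Fin 2 × Bool → ℝ) => ((l₁.map (fun a : Edge 3 L × Bool => if a.2 then ((fun (ee : Edge 3 L) => Matrix.of fun (i j : Fin 2) => ((y (ee, i, j, false) : ℝ) : ℂ) + ((y (ee, i, j, true) : ℝ) : ℂ) * Complex.I) a.1)ᴴ else (fun (ee : Edge 3 L) => Matrix.of fun (i j : Fin 2) => ((y (ee, i, j, false) : ℝ) : ℂ) + ((y (ee, i, j, true) : ℝ) : ℂ) * Complex.I) a.1)).prod).trace.re) (coords x), fun x => (fun y :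 (Edge 3 L × Fin 2 × Fin 2 × Bool → ℝ) => ((l₂.map (fun a : Edge 3 L × Bool => if a.2 then ((fun (ee : Edge 3 L) => Matrix.of fun (i j : Fin 2) => ((y (ee, i, j, false) : ℝ) : ℂ) + ((y (ee, i, j, true) : ℝ) : ℂ) * Complex.I) a.1)ᴴ else (fun (ee : Edge 3 L) => Matrix.of fun (i j : Fin 2) => ((y (ee, i, j, false) : ℝ) : ℂ) + ((y (ee, i, j, true) : ℝ) : ℂ) * Complex.I) a.1)).prod).trace.re) (coords x); (wilsonMeasure (d := 3) (L := L) (fundamentalRep (Fin 2)) β')]| ≤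
      32 * Real.pi ^ 2 * (l₁.length : ℝ) ^ 2 * (l₂.length : ℝ) ^ 2 * (1 + (((R : ℝ) + 1) * Real.log 108 / ((1300 + 4 * Real.sqrt 2) * |β'| + (1 - 12 * |β'|)))) * Real.exp (-((1 - 12 * |β'|) * (((R : ℝ) + 1) * Real.log 108 / ((1300 + 4 * Real.sqrt 2) * |β'| + (1 - 12 * |β'|))))) := by
  intro coords
  classical
  haveI := secondCountableTopology_su2
  haveI := borelSpace_config L
  haveI : IsProbabilityMeasure (wilsonMeasure (d := 3) (L := L) (fundamentalRep (Fin 2)) β') :=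
    isProbabilityMeasure_wilsonMeasure (d := 3) (L := L) (fundamentalRep (Fin 2)) (continuous_fundamentalRep (Fin 2)) β'
  have hco : Continuous coords := continuous_coords (L := L)
  have hFc : Continuous fun V => (fun y : (Edge 3 L × Fin 2 × Fin 2 × Bool → ℝ) => ((l₁.map (fun a : Edge 3 L × Bool => if a.2 then ((fun (ee : Edge 3 L) => Matrix.of fun (i j : Fin 2) => ((y (ee, i, j, false) : ℝ) : ℂ) + ((y (ee, i, j, true) : ℝ) : ℂ) * Complex.I) a.1)ᴴ else (fun (ee : Edge 3 L) => Matrix.of fun (i j : Fin 2) => ((y (ee, i, j, false) : ℝ) : ℂ) + ((y (ee, i, j, true) : ℝ) : ℂ) * Complex.I) a.1)).prod).trace.re) (coords V) := (contDiff_word (L := L) l₁ (m := 1)).continuous.comp hco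
  have hGc : Continuous fun V => (fun y : (Edge 3 L × Fin 2 × Fin 2 × Bool → ℝ) => ((l₂.map (fun a : Edge 3 L × Bool => if a.2 then ((fun (ee : Edge 3 L) => Matrix.of fun (i j : Fin 2) => ((y (ee, i, j, false) : ℝ) : ℂ) + ((y (ee, i, j, true) : ℝ) : ℂ) * Complex.I) a.1)ᴴ else (fun (ee : Edge 3 L) => Matrix.of fun (i j : Fin 2) => ((y (ee, i, j, false) : ℝ) : ℂ) + ((y (ee, i, j, true) : ℝ) : ℂ) * Complex.I) a.1)).prod).trace.re) (coords V) := (contDiff_word (L := L) l₂ (m := 1)).continuous.comp hco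
  obtain ⟨MF, -, hMF⟩ := exists_abs_le_of_continuous hFc
  obtain ⟨MG, -, hMG⟩ := exists_abs_le_of_continuous hGc
  have hX : MemLp (fun V => (fun y : (Edge 3 L × Fin 2 × Fin 2 × Bool → ℝ) => ((l₁.map (fun a : Edge 3 L × Bool => if a.2 then ((fun (ee : Edge 3 L) => Matrix.of fun (i j : Fin 2) => ((y (ee, i, j, false) : ℝ) : ℂ) + ((y (ee, i, j, true) : ℝ) : ℂ) * Complex.I) a.1)ᴴ else (fun (ee : Edge 3 L) => Matrix.of fun (i j : Fin 2) => ((y (ee, i, j, false) : ℝ) : ℂ) + ((y (ee, i, j, true) : ℝ) : ℂ) * Complex.I) a.1)).prod).trace.re) (coords V)) 2 (wilsonMeasure (d := 3) (L := L) (fundamentalRep (Fin 2)) β') :=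
    MemLp.of_bound hFc.aestronglyMeasurable MF (ae_of_all _ fun x => by rw [Real.norm_eq_abs]; exact hMF x)
  have hY : MemLp (fun V => (fun y : (Edge 3 L × Fin 2 × Fin 2 × Bool → ℝ) => ((l₂.map (fun a : Edge 3 L × Bool => if a.2 then ((fun (ee : Edge 3 L) => Matrix.of fun (i j : Fin 2) => ((y (ee, i, j, false) : ℝ) : ℂ) + ((y (ee, i, j, true) : ℝ) : ℂ) * Complex.I) a.1)ᴴ else (fun (ee : Edge 3 L) => Matrix.of fun (i j : Fin 2) => ((y (ee, i, j, false) : ℝ) : ℂ) + ((y (ee, i, j, true) : ℝ) : ℂ) * Complex.I) a.1)).prod).trace.re) (coords V)) 2 (wilsonMeasure (d := 3) (L := L) (fundamentalRep (Fin 2)) β') :=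
    MemLp.of_bound hGc.aestronglyMeasurable MG (ae_of_all _ fun x => by rw [Real.norm_eq_abs]; exact hMG x)
  rw [ProbabilityTheory.covariance_eq_sub hX hY]
  exact wilson_loop_covariance_abs_le L β' hβ l₁ l₂ R hsep

end Summit.QuantumFields.YangMills.Theorems.ColdStartUniversality.LiebRobinson
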